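import Summits.CriticalPhenomena.PercolationContinuityZ3.Theorems.PercNearOneGluingNoHeavyQuantSliceShallowZero
import HarnessLib

/-!
# QUANT lane R8, T-DEC: **THEOREM A⁺ — SL-λ* with deep, far-deep and shallow lows** (shallow lows incompatible with every charged
# band-like atom; far-deep lows `j′ < k + a` treated as shallow; no true mids ≤ j′ − a; g ≥ 1/2) (LEAD-NOTES-G23 N49 (4)(i), N51 (3)(b))

builds on p205010 (kernel theorem, internal audit signed; external expert review pending)

Support file (`--supports stmt-CriticalPhenomena-4575`), QUANT lane lead seat prim-quant-lead (gen 23), rung R8 of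
`run/shared/lean/prim/quant/LADDER.md`.  One small definition (the witness `dlFlowS`) and theorems; standard axioms, no sorries.  See
`…QuantSliceShallowZero` (part 1) for the statement in words and the pool inequality; Theorem A is `…QuantSliceDeepLows`.
* `dlFlowS` — Theorem A's witness `dlFlow` run on the zeroed law, plus the proportional pool split of the shallow lows' row-0 copies;
* **`slice_isFlowAtT_of_deepShallowLows_core`** (pool budget `hPB` as a hypothesis — the plug for Theorem D) / **`slice_isFlowAtT_of_deepShallowLows`** — `IsFlowAtT` of the slice (capacity at a pool position re-derived from `loadV_le`, `loadA_le`,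
  `sum_dlSrc_le` and `pool_budget_shallow`; elsewhere Theorem A's capacity clause for the zeroed law, which lies below the law);
* **`slice_decAtT_of_deepShallowLows`** — DEC form: probability law `ν` on `{0..M}`, `0 < x < 1`, `1 ≤ a ≤ j′`, `x ≤ g ≤ 1`, `1/2 ≤ g`,
  `λ ≤ j′ ≤ λ + a`; every charged low `k ≤ j′` deep, or shallow with `k ≤ λ` and `k + w ≤ T` for every charged band-like `w ≤ λ`; charged non-lows
  `≤ λ` band-like (`2k ≤ T′`); charged atoms in `(λ, j′]` true mids; THEN `DECAtT x T j′ M ν ∧ DECAtT x T λ M ν ⟹ DECAtT x (T+ag) j′ (M+a) (slice ν a g)`.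
OPEN after A⁺ (N49 (4)): shallow lows that DO meet a band atom (room g − (1−g)r_v on the band row-1 copy), true mids ≤ j′−a, window lows above λ, g < 1/2.

[this work]; nothing here is cited as a published result.  The gluing rows served [cite: KozmaNitzan2024, Conjecture 3 (p. 15)]; product
measure [cite: Grimmett1999, §1.3 p. 10].
-/

noncomputable section

namespace Summit.CriticalPhenomena.PercolationContinuityZ3.Theorems

namespace Quant

open Finset

namespace LawDec

section ShallowWitness

variable (x T g : ℝ) (j' M a lam : ℕ) (ν : ℕ → ℝ) (f0 : ℕ → ℕ → ℝ)

/-- **THE WITNESS WITH SHALLOW LOWS**: Theorem A's witness for the zeroed law, plus the row-0 copies of the shallow lows split over the pool. -/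
def dlFlowS (x T g : ℝ) (j' M a lam : ℕ) (ν : ℕ → ℝ) (f0 : ℕ → ℕ → ℝ) (q p : ℕ) : ℝ :=
  dlFlow x T g j' M a lam (zeroShallow T g j' lam a ν) (zeroShallowFlow T g j' lam a f0) q p
    + (if (q ≤ lam ∧ 2 * (q : ℝ) < T ∧ (T + (a : ℝ) * g ≤ 2 * ((q : ℝ) + a) ∨ j' < q + a)) ∧ p ≤ M + a then
        (1 - g) * ν q * dlPool g j' a lam (zeroShallow T g j' lam a ν) p / dlPoolTot g j' M lam (zeroShallow T g j' lam a ν) else 0)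

/-- **THEOREM A⁺, core form**: the witness `dlFlowS` is a flow of the slice for a law with deep and SHALLOW (`≤ λ`) lows whenever the
pool-bound mass of the deep routing on the zeroed law plus the shallow row-0 copies fits into the pool (`hPB`; supplied by
`pool_budget_shallow` in Theorem A⁺ and by the corner identity in Theorem D). [this work] -/
theorem slice_isFlowAtT_of_deepShallowLows_core (hx0 : 0 < x) (hx1 : x < 1) (hxg : x ≤ g) (hg1 : g ≤ 1)
    (ha : 1 ≤ a) (haj : a ≤ j') (hν : ∀ k, 0 ≤ ν k) (hνM : ∀ k, M < k → ν k = 0)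
    (hf0 : IsFlowAtT x T j' M ν f0) (hlamj : lam ≤ j') (hlam : j' ≤ lam + a)
    (hlows : ∀ k, k ≤ j' → 2 * (k : ℝ) < T → ν k ≠ 0 →
      (2 * ((k : ℝ) + a) < T + (a : ℝ) * g ∧ k + a ≤ j') ∨ ((T + (a : ℝ) * g ≤ 2 * ((k : ℝ) + a) ∨ j' < k + a) ∧ k ≤ lam))
    (habove : ∀ k, lam < k → k ≤ j' → ν k ≠ 0 → T + (a : ℝ) * g < 2 * (k : ℝ))
    (hPB : x / (1 - x) * (∑ l ∈ Finset.range (j' + 1), (if 2 * (l : ℝ) < T then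
        dlRest x T g j' a (zeroShallow T g j' lam a ν) (zeroShallowFlow T g j' lam a f0) l else 0)
      + (1 - g) * ∑ l ∈ Finset.range (j' + 1),
        (if l ≤ lam ∧ 2 * (l : ℝ) < T ∧ (T + (a : ℝ) * g ≤ 2 * ((l : ℝ) + a) ∨ j' < l + a) then ν l else 0))
      ≤ dlPoolTot g j' M lam (zeroShallow T g j' lam a ν)) :
    IsFlowAtT x (T + (a : ℝ) * g) j' (M + a) (slice ν a g) (dlFlowS x T g j' M a lam ν f0) := by
  set νD := zeroShallow T g j' lam a ν with hνD
  set f0D := zeroShallowFlow T g j' lam a f0 with hf0D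
  have hg0 : 0 ≤ g := hx0.le.trans hxg
  have hu : 0 < x / (1 - x) := div_pos hx0 (by linarith)
  have hνD0 : ∀ k, 0 ≤ νD k := zeroShallow_nonneg T g j' a lam ν hν
  have hνDM : ∀ k, M < k → νD k = 0 := zeroShallow_eq_zero T g j' M a lam ν hνM
  have hf0D' : IsFlowAtT x T j' M νD f0D := isFlowAtT_zeroShallow x T g j' M a lam ν j' f0 hx0 hx1 hlamj hf0
  have hdeepD : ∀ k, k ≤ j' → 2 * (k : ℝ) < T → νD k ≠ 0 → 2 * ((k : ℝ) + a) < T + (a : ℝ) * g ∧ k + a ≤ j' := by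
    intro k hk hlow hne
    have hne' := ne_zero_of_zeroShallow_ne_zero T g j' a lam ν k hne
    rcases hlows k hk hlow hne' with hd | ⟨hs, hkl⟩
    · exact hd
    · exfalso; apply hne; simp only [hνD]; unfold zeroShallow; rw [if_pos ⟨hkl, hlow, hs⟩]
  have haboveD : ∀ k, lam < k → k ≤ j' → νD k ≠ 0 → T + (a : ℝ) * g < 2 * (k : ℝ) :=
    fun k hk hkj hne => habove k hk hkj (ne_zero_of_zeroShallow_ne_zero T g j' a lam ν k hne)
  -- Theorem A's core for the zeroed law (its pool budget is the deep part of `hPB`)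
  have hSsh0 : 0 ≤ (1 - g) * ∑ l ∈ Finset.range (j' + 1),
      (if l ≤ lam ∧ 2 * (l : ℝ) < T ∧ (T + (a : ℝ) * g ≤ 2 * ((l : ℝ) + a) ∨ j' < l + a) then ν l else 0) :=
    mul_nonneg (by linarith) (Finset.sum_nonneg fun l _ => by split_ifs; exact hν l; exact le_rfl)
  have hRest0 : 0 ≤ ∑ l ∈ Finset.range (j' + 1), (if 2 * (l : ℝ) < T then dlRest x T g j' a νD f0D l else 0) :=
    Finset.sum_nonneg fun l _ => by
      split_ifs
      · unfold dlRest
        have h1 := sum_dlAd_le x T g j' a νD f0D hg0 hνD0 l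
        have h2 := mul_nonneg (show (0:ℝ) ≤ 1 - g by linarith) (hνD0 l)
        nlinarith
      · exact le_rfl
  have hPBA : x / (1 - x) * ∑ l ∈ Finset.range (j' + 1), (if 2 * (l : ℝ) < T then dlRest x T g j' a νD f0D l else 0)
      ≤ dlPoolTot g j' M lam νD := by
    have := mul_le_mul_of_nonneg_left (le_add_of_nonneg_right hSsh0 :
      ∑ l ∈ Finset.range (j' + 1), (if 2 * (l : ℝ) < T then dlRest x T g j' a νD f0D l else 0) ≤ _) hu.le
    exact this.trans hPB
  have hA := slice_isFlowAtT_of_deepLows_core x T g j' M a lam νD f0D hx0 hx1 hxg hg1 ha haj hνD0 hνDM hf0D' hlam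
    hdeepD haboveD hPBA
  have hpool0 : ∀ p, 0 ≤ dlPool g j' a lam νD p := dlPool_nonneg g j' a lam νD hg0 hg1 hνD0
  have htot0 : 0 ≤ dlPoolTot g j' M lam νD := dlPoolTot_nonneg g j' M lam νD hg0 hg1 hνD0
  -- the shallow part
  set Sh : ℕ → ℕ → ℝ := fun q p => if (q ≤ lam ∧ 2 * (q : ℝ) < T ∧ (T + (a : ℝ) * g ≤ 2 * ((q : ℝ) + a) ∨ j' < q + a)) ∧ p ≤ M + a then
      (1 - g) * ν q * dlPool g j' a lam νD p / dlPoolTot g j' M lam νD else 0 with hSh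
  have hShnn : ∀ q p, 0 ≤ Sh q p := fun q p => by
    simp only [hSh]; split_ifs
    · exact div_nonneg (mul_nonneg (mul_nonneg (by linarith) (hν q)) (hpool0 p)) htot0
    · exact le_rfl
  have eF : ∀ q p, dlFlowS x T g j' M a lam ν f0 q p = dlFlow x T g j' M a lam νD f0D q p + Sh q p := fun q p => rfl
  refine ⟨?_, ?_, ?_, ?_⟩
  · intro q p; rw [eF]; exact add_nonneg (hA.1 q p) (hShnn q p)
  · intro q p hqp
    rw [eF] at hqp
    by_cases h1 : 0 < dlFlow x T g j' M a lam νD f0D q p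
    · exact hA.2.1 q p h1
    · have h2 : 0 < Sh q p := by have := hA.1 q p; linarith
      simp only [hSh] at h2
      split_ifs at h2 with hc
      · have hag : 0 ≤ (a : ℝ) * g := mul_nonneg (Nat.cast_nonneg a) hg0
        refine ⟨by omega, by linarith [hc.1.2.1], hc.2, Or.inl ?_⟩
        refine giant_of_dlPool_ne g j' a lam νD hlam p ?_
        intro hz; rw [hz, mul_zero, zero_div] at h2; exact lt_irrefl _ h2
      · exact absurd h2 (lt_irrefl _)
  · -- shipping
    intro q hqj hq
    have hships := hA.2.2.1 q hqj hq
    rw [show (fun p => dlFlowS x T g j' M a lam ν f0 q p) = fun p => dlFlow x T g j' M a lam νD f0D q p + Sh q p from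
      funext fun p => eF q p, Finset.sum_add_distrib, hships]
    -- the shallow part sums to (1−g)ν q on a shallow q
    have hShsum : ∑ p ∈ Finset.range (M + a + 1), Sh q p
        = (if q ≤ lam ∧ 2 * (q : ℝ) < T ∧ (T + (a : ℝ) * g ≤ 2 * ((q : ℝ) + a) ∨ j' < q + a) then (1 - g) * ν q else 0) := by
      by_cases hs : q ≤ lam ∧ 2 * (q : ℝ) < T ∧ (T + (a : ℝ) * g ≤ 2 * ((q : ℝ) + a) ∨ j' < q + a)
      · rw [if_pos hs]
        have e : ∀ p ∈ Finset.range (M + a + 1), Sh q p = (1 - g) * ν q * dlPool g j' a lam νD p / dlPoolTot g j' M lam νD := by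
          intro p hp
          have hG : (q ≤ lam ∧ 2 * (q : ℝ) < T ∧ (T + (a : ℝ) * g ≤ 2 * ((q : ℝ) + a) ∨ j' < q + a)) ∧ p ≤ M + a :=
            ⟨hs, Nat.lt_succ_iff.1 (Finset.mem_range.1 hp)⟩
          simp only [hSh]; rw [if_pos hG]
        rw [Finset.sum_congr rfl e, ← Finset.sum_div, ← Finset.mul_sum, sum_dlPool g j' M a lam νD hνDM]
        by_cases ht : dlPoolTot g j' M lam νD = 0
        · -- empty pool: the budget forces every shallow row-0 copy to vanish
          rw [ht, div_zero]
          have h0 : (1 - g) * ∑ l ∈ Finset.range (j' + 1),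
              (if l ≤ lam ∧ 2 * (l : ℝ) < T ∧ (T + (a : ℝ) * g ≤ 2 * ((l : ℝ) + a) ∨ j' < l + a) then ν l else 0) = 0 := by
            rw [ht] at hPB
            have : x / (1 - x) * ((1 - g) * ∑ l ∈ Finset.range (j' + 1),
                (if l ≤ lam ∧ 2 * (l : ℝ) < T ∧ (T + (a : ℝ) * g ≤ 2 * ((l : ℝ) + a) ∨ j' < l + a) then ν l else 0)) ≤ 0 := by
              nlinarith [mul_nonneg hu.le hRest0]
            nlinarith [mul_nonneg hu.le hSsh0, hu]
          rcases (show (0:ℝ) ≤ 1 - g by linarith).eq_or_lt with hg1' | hgpos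
          · rw [← hg1']; ring
          · have hS0 : ∑ l ∈ Finset.range (j' + 1),
                (if l ≤ lam ∧ 2 * (l : ℝ) < T ∧ (T + (a : ℝ) * g ≤ 2 * ((l : ℝ) + a) ∨ j' < l + a) then ν l else 0) = 0 := by
              rcases mul_eq_zero.1 h0 with h | h
              · exact absurd h hgpos.ne'
              · exact h
            have hq0 := (Finset.sum_eq_zero_iff_of_nonneg (fun l _ => by
                show (0:ℝ) ≤ (if l ≤ lam ∧ 2 * (l : ℝ) < T ∧ (T + (a : ℝ) * g ≤ 2 * ((l : ℝ) + a) ∨ j' < l + a) then ν l else 0)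
                split_ifs; exact hν l; exact le_rfl)).1 hS0 q (Finset.mem_range.2 (by omega))
            rw [if_pos hs] at hq0
            rw [hq0]; ring
        · rw [mul_div_cancel_right₀ _ ht]
      · rw [if_neg hs]
        exact Finset.sum_eq_zero fun p _ => by simp only [hSh]; rw [if_neg (fun h => hs h.1)]
    rw [hShsum]
    -- compare slice ν with slice νD at the low position q
    unfold slice
    simp only [hνD]
    unfold zeroShallow
    have hnot : ∀ (hqa : a ≤ q), ¬ (q - a ≤ lam ∧ 2 * (((q - a : ℕ) : ℝ)) < T ∧
        (T + (a : ℝ) * g ≤ 2 * ((((q - a : ℕ) : ℝ)) + a) ∨ j' < q - a + a)) := by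
      intro hqa h
      have : (((q - a : ℕ) : ℝ)) + a = q := by rw [Nat.cast_sub hqa]; ring
      rw [this] at h
      rcases h.2.2 with h3 | h3
      · linarith [h3]
      · omega
    by_cases hqa : a ≤ q
    · rw [if_pos hqa, if_pos hqa, if_neg (hnot hqa)]
      split_ifs <;> ring
    · rw [if_neg hqa, if_neg hqa]
      split_ifs <;> ring
  · -- capacity
    intro p hpM hc
    have hcapA := hA.2.2.2 p hpM hc
    have hsl : slice νD a g p ≤ slice ν a g p := by
      unfold slice
      refine add_le_add (mul_le_mul_of_nonneg_left (zeroShallow_le T g j' a lam ν hν p) (by linarith))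
        (mul_le_mul_of_nonneg_left ?_ hg0)
      split_ifs
      · exact zeroShallow_le T g j' a lam ν hν _
      · exact le_rfl
    have e : ∀ q ∈ Finset.range (j' + 1), usage x (T + (a : ℝ) * g) j' q p * dlFlowS x T g j' M a lam ν f0 q p
        = usage x (T + (a : ℝ) * g) j' q p * dlFlow x T g j' M a lam νD f0D q p
          + usage x (T + (a : ℝ) * g) j' q p * Sh q p := by
      intro q _; rw [eF]; ring
    rw [Finset.sum_congr rfl e, Finset.sum_add_distrib]
    rcases (hpool0 p).eq_or_lt with hz | hpos
    · -- no pool mass at p: the shallow part vanishes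
      have hS0 : ∑ q ∈ Finset.range (j' + 1), usage x (T + (a : ℝ) * g) j' q p * Sh q p = 0 :=
        Finset.sum_eq_zero fun q _ => by
          simp only [hSh]; split_ifs
          · rw [← hz, mul_zero, zero_div, mul_zero]
          · rw [mul_zero]
      rw [hS0, add_zero]
      exact hcapA.trans hsl
    · -- a pool position: `p > j′`, giant usage; redo the pool accounting with the shallow sources
      have hgi : j' + 1 ≤ p := giant_of_dlPool_ne g j' a lam νD hlam p hpos.ne'
      have htpos : 0 < dlPoolTot g j' M lam νD := by
        refine lt_of_lt_of_le hpos ?_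
        rw [← sum_dlPool g j' M a lam νD hνDM]
        exact Finset.single_le_sum (f := fun p => dlPool g j' a lam νD p) (fun q _ => hpool0 q)
          (Finset.mem_range.2 (by omega))
      -- decompose Theorem A's loads at p
      have eA : ∀ q ∈ Finset.range (j' + 1), usage x (T + (a : ℝ) * g) j' q p * dlFlow x T g j' M a lam νD f0D q p
          = (if q ≤ j' ∧ 2 * (q : ℝ) < T + (a : ℝ) * g ∧ p ≤ M + a then
              usage x (T + (a : ℝ) * g) j' q p * (if T ≤ 2 * (q : ℝ) ∧ p = q + a then (1 - g) * νD q else 0) else 0)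
            + (if q ≤ j' ∧ 2 * (q : ℝ) < T + (a : ℝ) * g ∧ p ≤ M + a then
              usage x (T + (a : ℝ) * g) j' q p * (if a ≤ q ∧ p ≤ j' then dlAd x T g j' a νD f0D (q - a) p else 0) else 0)
            + (x / (1 - x) * (dlPool g j' a lam νD p / dlPoolTot g j' M lam νD))
              * (if 2 * (q : ℝ) < T + (a : ℝ) * g then dlSrc x T g j' a νD f0D q else 0) := by
        intro q hq
        have hqj : q ≤ j' := Nat.lt_succ_iff.1 (Finset.mem_range.1 hq)
        unfold dlFlow
        by_cases hlow : 2 * (q : ℝ) < T + (a : ℝ) * g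
        · have hG : q ≤ j' ∧ 2 * (q : ℝ) < T + (a : ℝ) * g ∧ p ≤ M + a := ⟨hqj, hlow, hpM⟩
          rw [if_pos hG, if_pos hG, if_pos hG, if_pos hlow, usage_giant_eq x _ j' q p hgi]; ring
        · have hG : ¬ (q ≤ j' ∧ 2 * (q : ℝ) < T + (a : ℝ) * g ∧ p ≤ M + a) := fun h => hlow h.2.1
          rw [if_neg hG, if_neg hG, if_neg hG, if_neg hlow]; ring
      have eS : ∀ q ∈ Finset.range (j' + 1), usage x (T + (a : ℝ) * g) j' q p * Sh q p
          = (x / (1 - x) * (dlPool g j' a lam νD p / dlPoolTot g j' M lam νD))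
              * ((1 - g) * (if q ≤ lam ∧ 2 * (q : ℝ) < T ∧ (T + (a : ℝ) * g ≤ 2 * ((q : ℝ) + a) ∨ j' < q + a) then ν q else 0)) := by
        intro q _
        simp only [hSh]
        by_cases hs : q ≤ lam ∧ 2 * (q : ℝ) < T ∧ (T + (a : ℝ) * g ≤ 2 * ((q : ℝ) + a) ∨ j' < q + a)
        · rw [if_pos ⟨hs, hpM⟩, if_pos hs, usage_giant_eq x _ j' q p hgi]; ring
        · rw [if_neg (fun h => hs h.1), if_neg hs]; ring
      rw [Finset.sum_congr rfl eA, Finset.sum_add_distrib, Finset.sum_add_distrib, Finset.sum_congr rfl eS,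
        ← Finset.mul_sum, ← Finset.mul_sum, ← Finset.mul_sum]
      have hT2 : j' + 1 ≤ p ∨ T ≤ 2 * (p : ℝ) := Or.inl hgi
      have h1 := loadV_le x T g j' M a νD hx0 hxg hg1 ha hνD0 p
      have h2 := loadA_le x T g j' M a νD f0D hx0 hx1 hg0 hg1 haj hνD0 hf0D' hdeepD p hT2
      have hS := sum_dlSrc_le x T g j' a νD f0D ha haj hg0 hg1 hνD0
      have hkey : x / (1 - x) * (∑ q ∈ Finset.range (j' + 1),
            (if 2 * (q : ℝ) < T + (a : ℝ) * g then dlSrc x T g j' a νD f0D q else 0)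
          + (1 - g) * ∑ q ∈ Finset.range (j' + 1),
            (if q ≤ lam ∧ 2 * (q : ℝ) < T ∧ (T + (a : ℝ) * g ≤ 2 * ((q : ℝ) + a) ∨ j' < q + a) then ν q else 0))
          ≤ dlPoolTot g j' M lam νD := by
        refine le_trans ?_ hPB
        refine mul_le_mul_of_nonneg_left (add_le_add hS le_rfl) hu.le
      have hPS : (x / (1 - x) * (dlPool g j' a lam νD p / dlPoolTot g j' M lam νD))
          * ∑ q ∈ Finset.range (j' + 1), (if 2 * (q : ℝ) < T + (a : ℝ) * g then dlSrc x T g j' a νD f0D q else 0)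
          + (x / (1 - x) * (dlPool g j' a lam νD p / dlPoolTot g j' M lam νD))
          * ((1 - g) * ∑ q ∈ Finset.range (j' + 1),
              (if q ≤ lam ∧ 2 * (q : ℝ) < T ∧ (T + (a : ℝ) * g ≤ 2 * ((q : ℝ) + a) ∨ j' < q + a) then ν q else 0))
          ≤ dlPool g j' a lam νD p := by
        rw [← mul_add]
        set W := ∑ q ∈ Finset.range (j' + 1), (if 2 * (q : ℝ) < T + (a : ℝ) * g then dlSrc x T g j' a νD f0D q else 0)
          + (1 - g) * ∑ q ∈ Finset.range (j' + 1),
            (if q ≤ lam ∧ 2 * (q : ℝ) < T ∧ (T + (a : ℝ) * g ≤ 2 * ((q : ℝ) + a) ∨ j' < q + a) then ν q else 0)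
        calc x / (1 - x) * (dlPool g j' a lam νD p / dlPoolTot g j' M lam νD) * W
            = (x / (1 - x) * W) * dlPool g j' a lam νD p / dlPoolTot g j' M lam νD := by ring
          _ ≤ dlPoolTot g j' M lam νD * dlPool g j' a lam νD p / dlPoolTot g j' M lam νD :=
                div_le_div_of_nonneg_right (mul_le_mul_of_nonneg_right hkey (hpool0 p)) htpos.le
          _ = dlPool g j' a lam νD p := by field_simp
      -- assemble as in Theorem A, for νD, then compare with slice ν
      have hrow0 : (if p ≤ j' then (1 - g) * νD p else 0) + (1 - g) * (if j' + 1 ≤ p then νD p else 0) = (1 - g) * νD p := by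
        rw [if_neg (by omega), if_pos hgi]; ring
      have hrow1 : g * (if a ≤ p ∧ p - a ≤ j' ∧ 2 * (((p - a : ℕ) : ℝ)) < T + (a : ℝ) * g then νD (p - a) else 0)
          + g * (if a ≤ p ∧ lam + 1 ≤ p - a then νD (p - a) else 0) ≤ g * (if a ≤ p then νD (p - a) else 0) := by
        have hνpa := hνD0 (p - a)
        by_cases hap : a ≤ p
        · by_cases hl : lam + 1 ≤ p - a
          · by_cases hv : a ≤ p ∧ p - a ≤ j' ∧ 2 * (((p - a : ℕ) : ℝ)) < T + (a : ℝ) * g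
            · have hz : νD (p - a) = 0 := by
                by_contra hne
                have := haboveD (p - a) (by omega) hv.2.1 hne
                linarith [hv.2.2]
              rw [if_pos hv, if_pos (show a ≤ p ∧ lam + 1 ≤ p - a from ⟨hap, hl⟩), if_pos hap, hz]; linarith
            · rw [if_neg hv, if_pos (show a ≤ p ∧ lam + 1 ≤ p - a from ⟨hap, hl⟩), if_pos hap]; linarith
          · rw [if_neg (show ¬ (a ≤ p ∧ lam + 1 ≤ p - a) from fun h => hl h.2), if_pos hap]
            split_ifs <;> nlinarith
        · rw [if_neg (show ¬ (a ≤ p ∧ p - a ≤ j' ∧ 2 * (((p - a : ℕ) : ℝ)) < T + (a : ℝ) * g) from fun h => hap h.1),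
            if_neg (show ¬ (a ≤ p ∧ lam + 1 ≤ p - a) from fun h => hap h.1), if_neg hap]; linarith
      have hfin : (1 - g) * νD p + g * (if a ≤ p then νD (p - a) else 0) ≤ slice ν a g p := by
        have : slice νD a g p = (1 - g) * νD p + g * (if a ≤ p then νD (p - a) else 0) := rfl
        linarith [hsl]
      unfold dlPool at hPS ⊢
      linarith [h1, h2, hPS, hrow0, hrow1, hfin]

/-- **THEOREM A⁺ (lead g23, N49 (4)(i)): SL-λ* with deep lows, SHALLOW lows that see no charged band-like atom, band-like atoms `≤ λ`,
window true mids `> λ`, giants; `g ≥ 1/2`.**  Witness `dlFlowS`; budget `pool_budget_shallow`. [this work] -/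
theorem slice_isFlowAtT_of_deepShallowLows (fl : ℕ → ℕ → ℝ) (hx0 : 0 < x) (hx1 : x < 1) (hxg : x ≤ g) (hg1 : g ≤ 1)
    (hg2 : 1 / 2 ≤ g) (ha : 1 ≤ a) (haj : a ≤ j') (hν : ∀ k, 0 ≤ ν k) (hνM : ∀ k, M < k → ν k = 0)
    (hf0 : IsFlowAtT x T j' M ν f0) (hfl : IsFlowAtT x T lam M ν fl) (hlamj : lam ≤ j') (hlam : j' ≤ lam + a)
    (hlows : ∀ k, k ≤ j' → 2 * (k : ℝ) < T → ν k ≠ 0 →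
      (2 * ((k : ℝ) + a) < T + (a : ℝ) * g ∧ k + a ≤ j') ∨
      ((T + (a : ℝ) * g ≤ 2 * ((k : ℝ) + a) ∨ j' < k + a) ∧ k ≤ lam ∧
        ∀ w, w ≤ lam → T ≤ 2 * (w : ℝ) → ν w ≠ 0 → (k : ℝ) + w ≤ T))
    (hbelow : ∀ k, k ≤ lam → T ≤ 2 * (k : ℝ) → ν k ≠ 0 → 2 * (k : ℝ) ≤ T + (a : ℝ) * g)
    (habove : ∀ k, lam < k → k ≤ j' → ν k ≠ 0 → T + (a : ℝ) * g < 2 * (k : ℝ)) :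
    IsFlowAtT x (T + (a : ℝ) * g) j' (M + a) (slice ν a g) (dlFlowS x T g j' M a lam ν f0) := by
  have hg0 : 0 ≤ g := hx0.le.trans hxg
  have hPB := pool_budget_shallow x T g j' M a lam ν f0 fl hx0 hx1 hg0 hg1 hg2 hν hf0 hfl hlamj hlows hbelow habove
  have htotD : dlPoolTot g j' M lam (zeroShallow T g j' lam a ν) = (1 - g) * ∑ h ∈ Finset.Ico (j' + 1) (M + 1), ν h
      + g * ∑ h ∈ Finset.Ico (lam + 1) (M + 1), ν h := by
    unfold dlPoolTot
    rw [sum_Ico_zeroShallow T g j' M a lam ν (j' + 1) (by omega), sum_Ico_zeroShallow T g j' M a lam ν (lam + 1) le_rfl]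
  rw [← htotD] at hPB
  exact slice_isFlowAtT_of_deepShallowLows_core x T g j' M a lam ν f0 hx0 hx1 hxg hg1 ha haj hν hνM hf0 hlamj hlam
    (fun k hk hlow hne => (hlows k hk hlow hne).imp id (fun h => ⟨h.1, h.2.1⟩)) habove hPB

/-- **THEOREM A⁺, DEC form.** [this work] -/
theorem slice_decAtT_of_deepShallowLows (hx0 : 0 < x) (hx1 : x < 1) (hxg : x ≤ g) (hg1 : g ≤ 1) (hg2 : 1 / 2 ≤ g)
    (ha : 1 ≤ a) (haj : a ≤ j') (hν : ∀ k, 0 ≤ ν k) (hνM : ∀ k, M < k → ν k = 0)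
    (hν1 : ∑ h ∈ Finset.range (M + 1), ν h = 1)
    (hdj : DECAtT x T j' M ν) (hdl : DECAtT x T lam M ν) (hlamj : lam ≤ j') (hlam : j' ≤ lam + a)
    (hlows : ∀ k, k ≤ j' → 2 * (k : ℝ) < T → ν k ≠ 0 →
      (2 * ((k : ℝ) + a) < T + (a : ℝ) * g ∧ k + a ≤ j') ∨
      ((T + (a : ℝ) * g ≤ 2 * ((k : ℝ) + a) ∨ j' < k + a) ∧ k ≤ lam ∧
        ∀ w, w ≤ lam → T ≤ 2 * (w : ℝ) → ν w ≠ 0 → (k : ℝ) + w ≤ T))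
    (hbelow : ∀ k, k ≤ lam → T ≤ 2 * (k : ℝ) → ν k ≠ 0 → 2 * (k : ℝ) ≤ T + (a : ℝ) * g)
    (habove : ∀ k, lam < k → k ≤ j' → ν k ≠ 0 → T + (a : ℝ) * g < 2 * (k : ℝ)) :
    DECAtT x (T + (a : ℝ) * g) j' (M + a) (slice ν a g) := by
  obtain ⟨f0, hf0⟩ := flowAtT_of_decAtT x T j' M ν hx0 hx1 hdj
  obtain ⟨fl, hfl⟩ := flowAtT_of_decAtT x T lam M ν hx0 hx1 hdl
  refine decAtT_of_flowAtT x _ j' (M + a) (slice ν a g) hx0 hx1 (slice_eq_zero ν a g M hνM) (sum_slice ν a g M hνM hν1) ?_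
  exact ⟨_, slice_isFlowAtT_of_deepShallowLows x T g j' M a lam ν f0 fl hx0 hx1 hxg hg1 hg2 ha haj hν hνM hf0 hfl hlamj hlam
    hlows hbelow habove⟩

end ShallowWitness

end LawDec

end Quant

end Summit.CriticalPhenomena.PercolationContinuityZ3.Theorems
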